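import Summits.BirchSwinnertonDyer.BirchSwinnertonDyer.Theses.SemiOrdinaryEisensteinDescent
import Summits.BirchSwinnertonDyer.BirchSwinnertonDyer.Theorems.SemiOrdinaryEisensteinDescentWildSplitEisensteinInclusionAtThreeStubSaturate
import Summits.BirchSwinnertonDyer.BirchSwinnertonDyer.Theorems.SemiOrdinaryEisensteinDescentWildSplitEisensteinInclusionAtThreeMuHalfOfPrint
import Literature.NumberTheory.EllipticCurves.Hsieh2014.AnticyclotomicMuInvariantAnyLevel
import HarnessLib

/-!
# Crux E `WildSplitEisensteinInclusionAtThree` (stmt-BirchSwinnertonDyer-20479), line `birth` — LEAD SKELETON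

Route `SemiOrdinaryEisensteinDescent` (SOED). This is the registered birth skeleton of planner bsd-wall-pss3 g4
(sha16 4d547c0373835491; stubs VERBATIM) re-typed by the lead prover bsd-wall-soed-p1 g0 with the LANDED stub
`stub_saturate` (p545527, `Theorems/SemiOrdinaryEisensteinDescentWildSplitEisensteinInclusionAtThreeStubSaturate.lean`)
imported instead of sorried, and — RESHAPE v2 (lead, 2026-08-27T21:1xZ) — the `μ`-stub `stub_frameMuZero` REPLACED by
its landed conditional proof `WildSplitEisensteinInclusionAtThreeMuHalfOfPrint.stub_frameMuZero_of_thmB_anyLevel` (p567302: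
the registered `μ`-signature VERBATIM behind the one refereed named fact below; (Irr_K) discharged from `ρ̄₃` onto, frame
transport by X11b cross-period rigidity) fed by the NEW stub `stub_hsiehThmBAnyLevel` = that named fact ITSELF (a pure
literature discharge: Hsieh, Doc. Math. 19 (2014) Thm. B at every level). Composition (`WildSplitEisensteinInclusionAtThree_of`,
sorry-free):

  crux ⟸ stub_semiOrdinaryTransferUpToPPower   (THE LEVER: `∃ k, 3^k · Ch_Λ(X_(∅,0))·R₀⟦T⟧ ⊆ (L)` — the Eisenstein
                                                 inclusion after inverting 3, Wan arXiv:1412.1767 Thm 1.1(2) shape,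
                                                 semi-ordinary U(3,1) Klingen–Eisenstein family with a SUPERCUSPIDAL
                                                 local datum at 3; research content, no engine in tree or print —
                                                 lead's presearch 2026-08-27: Wan 1607.07729 / Fouquet–Wan 2107.13726
                                                 Thm 4.41 need `π_p` crystalline, arXiv:2410.13132 regularly ordinary)
       + stub_hsiehThmBAnyLevel                 (NEW v2: the named fact `Hsieh2014.thmB_…_unrPeriod_anyLevel` — discharge
                                                 = formalising Hsieh 2014 §3–§6; gives `μ(L) = 0` through p567302)
       + stub_saturate                          (LANDED p545527: saturation at the prime 3 of `R₀⟦T⟧`).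
  (v1's `stub_frameMuZero` is no longer a stub: it is the THEOREM `stub_frameMuZero_of_thmB_anyLevel stub_hsiehThmBAnyLevel`.)

BSD is not proved by any of this.
-/

set_option autoImplicit false
set_option linter.dupNamespace false

noncomputable section

open scoped Classical

namespace Summit.BirchSwinnertonDyer.BirchSwinnertonDyer.Theorems.SemiOrdinaryEisensteinDescentWildSplitEisensteinInclusionAtThree

open Summit.BirchSwinnertonDyer.BirchSwinnertonDyer.Theses.SemiOrdinaryEisensteinDescent
  Summit.BirchSwinnertonDyer.BirchSwinnertonDyer.Theorems
  Summit.BirchSwinnertonDyer.BirchSwinnertonDyer.Theorems.WildSplitEisensteinInclusionAtThreeSaturate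

/-- **Stub (THE LEVER) `stub_semiOrdinaryTransferUpToPPower`** — registered signature verbatim (skeleton sha16
4d547c0373835491): under the crux's binders, the Eisenstein inclusion UP TO A POWER OF 3:
`∃ k, ∀ x ∈ Ch_Λ(X_(∅,0))·R₀⟦T⟧, 3^k · x ∈ (L)`. Intended engine: Wan's semi-ordinary `U(3,1)` Klingen–Eisenstein
congruences (arXiv:1412.1767 Thm 1.1, good supersingular `p`, square-free `N`) transferred to a supercuspidal `π₃`
of conductor `3^f`, `f ∈ {3,4,5}` — NOT in print (research stub). -/
theorem stub_semiOrdinaryTransferUpToPPower :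
    ∀ (W : WeierstrassCurve ℚ) [W.IsElliptic] [W.IsGloballyMinimal] (N : ℕ) [NeZero N] (K : Type) [Field K] [NumberField K] (Dt : Literature.NumberTheory.EllipticCurves.ModularForms.ModularParametrizationData W N), Summit.BirchSwinnertonDyer.Rank1Residual.Additive.ClassO6 W 3 → W.HasSurjectiveModNGaloisRep 3 → W.analyticRank = 1 → W.conductorNorm ℤ = N → Literature.NumberTheory.EllipticCurves.IsImaginaryQuadratic K → Literature.NumberTheory.EllipticCurves.SatisfiesHeegnerHypothesis N K → ∀ (κ : Literature.NumberTheory.EllipticCurves.ZpExtension K 3), κ.IsAnticyclotomic → ∀ (γ : Field.absoluteGaloisGroup K) [Fact (κ.IsTopGenerator γ)] (𝔭 : IsDedekindDomain.HeightOneSpectrum (NumberField.RingOfIntegers K)), ((3 : ℕ) : NumberField.RingOfIntegers K) ∈ 𝔭.asIdeal → 𝔭.asIdeal.ramificationIdx (NumberField.RingOfIntegers ℚ) = 1 → 𝔭.asIdeal.inertiaDeg (NumberField.RingOfIntegers ℚ) = 1 → ∀ (𝔭' : IsDedekindDomain.HeightOneSpectrum (NumberField.RingOfIntegers K)), ((3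 : ℕ) : NumberField.RingOfIntegers K) ∈ 𝔭'.asIdeal → 𝔭' ≠ 𝔭 → ∀ (ι' : PadicAlgCl 3 ≃+* ℂ), Summit.BirchSwinnertonDyer.BirchSwinnertonDyer.Theorems.SchneiderFree.BranchInducesPrime 3 ι' 𝔭 → ∀ (ΩK : ℂ) (Ωp : ℂ_[3]) (L : Literature.NumberTheory.EllipticCurves.UnrSeries 3), ΩK ≠ 0 → Ωp ≠ 0 → Literature.NumberTheory.EllipticCurves.IsBDPLFunction ι' 𝔭 κ γ Dt.f ΩK Ωp L → Module.IsTorsion (Literature.NumberTheory.EllipticCurves.IwasawaAlgebra 3) (Summit.BirchSwinnertonDyer.Rank1Residual.X11b.AcSelmer.XAc (W.baseChange K) 3 κ 𝔭' ∅ γ) → ∃ k : ℕ, ∀ x ∈ ((Summit.BirchSwinnertonDyer.Rank1Residual.X11b.AcSelmer.XAc.charIdeal (W.baseChange K) 3 κ 𝔭' ∅ γ).map (PowerSeries.map (Summit.BirchSwinnertonDyer.Rank1Residual.X11b.Halves.toUnr 3))), (3 : Literature.NumberTheory.EllipticCurves.UnrSeries 3) ^ k * x ∈ Ideal.span {L}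 := by
  sorry

/-- **Stub `stub_hsiehThmBAnyLevel`** (NEW in reshape v2; replaces v1's `stub_frameMuZero`, whose transport part is now
the landed theorem `stub_frameMuZero_of_thmB_anyLevel`, p567302): the tree's refereed NAMED FACT — Hsieh, *Special values of
anticyclotomic Rankin–Selberg L-functions*, Doc. Math. 19 (2014), Thm. B (= Thm. 6.2) at every level with the `p`-adic CM
period in `R₀ˣ` (`Literature.NumberTheory.EllipticCurves.Hsieh2014.thmB_exists_isHsiehLFunction_coeff_norm_eq_one_unrPeriod_anyLevel`,
typed by bed-p1 g0, audited ty-1 g9/g10). Closing this stub = DISCHARGING that fact (`…_holds`), a literature-prover task of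
size XL (formalising Hsieh §3–§6); until then crux E closes at best CONDITIONALLY on it (gate: `conditional-result`). -/
theorem stub_hsiehThmBAnyLevel :
    Literature.NumberTheory.EllipticCurves.Hsieh2014.thmB_exists_isHsiehLFunction_coeff_norm_eq_one_unrPeriod_anyLevel := by
  sorry

/-- **Composition** (sorry-free): the crux `WildSplitEisensteinInclusionAtThree` BY NAME from the registered stubs — the
lever gives `3^k · Ch·R₀⟦T⟧ ⊆ (L)`; `μ(L) = 0` is the landed theorem `stub_frameMuZero_of_thmB_anyLevel` (p567302) applied to
the stub `stub_hsiehThmBAnyLevel` (Hsieh Thm. B by name); the landed `stub_saturate` (p545527) saturates at the prime `3` of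
`R₀⟦T⟧`. -/
theorem WildSplitEisensteinInclusionAtThree_of : WildSplitEisensteinInclusionAtThree := by
  intro W _ _ N _ K _ _ Dt hO6 hsurj hr1 hN hK hH κ hκ γ _ 𝔭 h𝔭 he hf 𝔭' h𝔭' hne ι' hι ΩK Ωp L hΩK hΩp hL htor
  exact stub_saturate _ L
    (WildSplitEisensteinInclusionAtThreeMuHalfOfPrint.stub_frameMuZero_of_thmB_anyLevel stub_hsiehThmBAnyLevel W N K Dt hO6
      hsurj hr1 hN hK hH κ hκ γ 𝔭 h𝔭 he hf 𝔭' h𝔭' hne ι' hι ΩK Ωp L hΩK hΩp hL htor)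
    (stub_semiOrdinaryTransferUpToPPower W N K Dt hO6 hsurj hr1 hN hK hH κ hκ γ 𝔭 h𝔭 he hf 𝔭' h𝔭' hne ι' hι ΩK Ωp
      L hΩK hΩp hL htor)

end Summit.BirchSwinnertonDyer.BirchSwinnertonDyer.Theorems.SemiOrdinaryEisensteinDescentWildSplitEisensteinInclusionAtThree

end
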